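import Summits.Langlands.Langlands.Theses.EisensteinGelfandKirillov
import Summits.Langlands.Langlands.Theorems.EisensteinGelfandKirillovCrystallineProModularClassicalDefs
import Literature.NumberTheory.Automorphic.ResGLnCohomology
import Literature.NumberTheory.Automorphic.HeckeAlgebraPointEigenvector
import Literature.NumberTheory.Automorphic.ResGLnCohomologyHeckeCommute

/-!
# Route `EisensteinGelfandKirillov`, crux `CrystallineProModularClassical` (stmt-Langlands-18274),
# line `torsion-weight-exchange`: stub S4 `stub_exactOccupancy` ("First lemma") — PROVED

Stub-worker file for the registered stub `stub_exactOccupancy` of the checked skeleton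
`Cruxes/CrystallineProModularClassical/Lines/torsion_weight_exchange.lean` (lead rev 2), in the
skeleton's namespace `Summit.Langlands.Langlands.Cruxes.CrystallineProModularClassical.TorsionWeightExchange`,
over the landed line vocabulary `EisensteinGelfandKirillovCrystallineProModularClassicalDefs`
(`FactorsThroughWeightModP`, `IsClassicalOfWeight`, `IsIntegralPoly`).

**What is proved (unconditionally; no named fact is consumed).**
* The commutativity of the good Hecke operators `T_{v,i}`, `T_{w,j}` (`v, w ∤ 𝔫`) on
  `H^q(S_{K_f(𝔫)}, Ẽ_λ(k))` (`ResGLnCohomology.heckeT`; any field `k`, any `n`, any number field)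
  was landed FIRST as the Literature theorem `ResGLnCohomology.heckeT_comm` / `commute_heckeT`
  (`Literature/NumberTheory/Automorphic/ResGLnCohomologyHeckeCommute.lean`, by-product of this stub):
  `K_f(𝔫)` is unramified at `v ∤ 𝔫` (`BigHeckeGLn.isUnramifiedLevel_comap_principalCongruenceLevel`),
  `t_{v,i} = ιᵥ(diag)` (`heckeElement_eq_ofLocal`), different places by orthogonality, one place by
  Gelfand's trick (transpose + Cartan), functoriality of group cohomology — the proof of
  `BigHeckeGLn.TameLevel.heckeGenerators_commute_holds` transplanted to the twisted receptacle.
* `exists_eq_lift_fin`: an element of a free algebra on any type involves finitely many letters.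
* `exists_isIntegralPoly_smul`: every `P : ℚ̄_p⟨X_1..X_r⟩` becomes integral after scaling by `p^M`
  (`‖p‖ = p⁻¹`, the tree's `Literature.NumberTheory.GaloisRepresentations.norm_natCast_padicAlgCl`;
  finitely many coefficients); `lift_apply_eq_zero_of_forall_factorsThroughWeightModP`:
  hence `C_s` for all `s` makes EVERY relation among the good `T_{v,i}` exact on the values `x(T_{v,i})`.
* `stub_exactOccupancy` (the registered signature, verbatim): the values `x(T_{v,i})` therefore
  define an algebra character `χ` of `B = ℚ̄_p⟨good T_{v,i}⟩ = range (FreeAlgebra.lift T) ⊆ End H`;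
  `B` is commutative (`ResGLnCohomology.commute_heckeT` +
  `Algebra.commute_of_mem_adjoin_of_forall_mem_commute`), so
  `Literature.NumberTheory.Automorphic.exists_ne_zero_forall_apply_eq_smul_of_algHom` (with the
  finite-dimensionality HYPOTHESIS of the stub) yields a non-zero common eigenvector: `IsClassicalOfWeight`.
  The degenerate receptacle `H = 0` is excluded automatically (`P = 1` would be an exact relation
  with value `1`).
* Tried / not needed: no `𝒪`-lattice, no quotient of the free algebra (the character is built by
  choice of preimages, well defined by the exactness of relations), no case split on `H = 0`.
-/

-- the registered stub namespace `Summit.Langlands.Langlands.…` repeats `Langlands` (summit = problem name)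
set_option linter.dupNamespace false
set_option autoImplicit false

noncomputable section

open Literature.NumberTheory.Automorphic Literature.NumberTheory.Automorphic.BigHeckeGLn
open NumberField IsDedekindDomain

namespace Summit.Langlands.Langlands.Cruxes.CrystallineProModularClassical.TorsionWeightExchange

open Summit.Langlands.Langlands.Theses.EisensteinGelfandKirillov
open Literature.NumberTheory.GaloisRepresentations Literature.NumberTheory.PAdicHodge Filter
open scoped Classical

/-! ## 1. Finitely many letters; integrality by scaling; exactness of relations -/

section FreeAlgebraFin

variable {R : Type*} [CommSemiring R] {X Y A : Type*} [Semiring A] [Algebra R A]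

/-- `lift f (lift (ι ∘ e) P) = lift (f ∘ e) P`: substituting letters along `e : X → Y` and then
evaluating is evaluating at `f ∘ e` (`FreeAlgebra.hom_ext`). [folklore] -/
theorem lift_lift_ι_comp (f : Y → A) (e : X → Y) (P : FreeAlgebra R X) :
    FreeAlgebra.lift R f (FreeAlgebra.lift R (FreeAlgebra.ι R ∘ e) P) =
      FreeAlgebra.lift R (f ∘ e) P := by
  have h : (FreeAlgebra.lift R f).comp (FreeAlgebra.lift R (FreeAlgebra.ι R ∘ e)) =
      FreeAlgebra.lift R (f ∘ e) :=
    FreeAlgebra.hom_ext (funext fun x => by simp)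
  exact AlgHom.congr_fun h P

/-- **Every non-commutative polynomial involves finitely many letters**: each `P : FreeAlgebra R Y`
is `lift (ι ∘ e) P'` for some `e : Fin r → Y` and `P' : FreeAlgebra R (Fin r)`
(`FreeAlgebra.induction`; index maps combined with `Fin.append`). [folklore] -/
theorem exists_eq_lift_fin (P : FreeAlgebra R Y) :
    ∃ (r : ℕ) (e : Fin r → Y) (P' : FreeAlgebra R (Fin r)),
      P = FreeAlgebra.lift R (FreeAlgebra.ι R ∘ e) P' := by
  induction P using FreeAlgebra.induction with
  | grade0 c =>
    exact ⟨0, Fin.elim0, algebraMap R _ c, ((FreeAlgebra.lift R _).commutes c).symm⟩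
  | grade1 y =>
    exact ⟨1, fun _ => y, FreeAlgebra.ι R 0, by simp⟩
  | mul a b ha hb =>
    obtain ⟨r₁, e₁, P₁, rfl⟩ := ha
    obtain ⟨r₂, e₂, P₂, rfl⟩ := hb
    have h₁ : (FreeAlgebra.ι R ∘ Fin.append e₁ e₂) ∘ Fin.castAdd r₂ = FreeAlgebra.ι R ∘ e₁ :=
      funext fun x => by simp
    have h₂ : (FreeAlgebra.ι R ∘ Fin.append e₁ e₂) ∘ Fin.natAdd r₁ = FreeAlgebra.ι R ∘ e₂ :=
      funext fun x => by simp
    refine ⟨r₁ + r₂, Fin.append e₁ e₂,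
      FreeAlgebra.lift R (FreeAlgebra.ι R ∘ Fin.castAdd r₂) P₁ *
        FreeAlgebra.lift R (FreeAlgebra.ι R ∘ Fin.natAdd r₁) P₂, ?_⟩
    rw [map_mul, lift_lift_ι_comp, lift_lift_ι_comp, h₁, h₂]
  | add a b ha hb =>
    obtain ⟨r₁, e₁, P₁, rfl⟩ := ha
    obtain ⟨r₂, e₂, P₂, rfl⟩ := hb
    have h₁ : (FreeAlgebra.ι R ∘ Fin.append e₁ e₂) ∘ Fin.castAdd r₂ = FreeAlgebra.ι R ∘ e₁ :=
      funext fun x => by simp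
    have h₂ : (FreeAlgebra.ι R ∘ Fin.append e₁ e₂) ∘ Fin.natAdd r₁ = FreeAlgebra.ι R ∘ e₂ :=
      funext fun x => by simp
    refine ⟨r₁ + r₂, Fin.append e₁ e₂,
      FreeAlgebra.lift R (FreeAlgebra.ι R ∘ Fin.castAdd r₂) P₁ +
        FreeAlgebra.lift R (FreeAlgebra.ι R ∘ Fin.natAdd r₁) P₂, ?_⟩
    rw [map_add, lift_lift_ι_comp, lift_lift_ι_comp, h₁, h₂]

end FreeAlgebraFin

section Padic

variable {p : ℕ} [Fact p.Prime]

/-- An element of `ℚ̄_p` of norm `≤ p^{-s}` for every `s` is `0` (`p⁻¹ < 1`). [folklore] -/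
theorem eq_zero_of_forall_norm_le_inv_pow {a : PadicAlgCl p}
    (h : ∀ s : ℕ, ‖a‖ ≤ ((p : ℝ)⁻¹) ^ s) : a = 0 := by
  by_contra ha
  obtain ⟨s, hs⟩ := exists_pow_lt_of_lt_one (norm_pos_iff.2 ha)
    (inv_lt_one_of_one_lt₀ (by exact_mod_cast (Fact.out : p.Prime).one_lt) : (p : ℝ)⁻¹ < 1)
  exact absurd (h s) (not_le.2 hs)

/-- **Integrality is free by scaling**: every `P : ℚ̄_p⟨X_1, …, X_r⟩` has finitely many non-zero
coefficients, so `p^M • P` is integral (`IsIntegralPoly`) for `M` large (`‖p^M c‖ = p^{-M} ‖c‖`).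
[folklore] -/
theorem exists_isIntegralPoly_smul {r : ℕ} (P : FreeAlgebra (PadicAlgCl p) (Fin r)) :
    ∃ M : ℕ, IsIntegralPoly ((p : PadicAlgCl p) ^ M • P) := by
  obtain ⟨M, hM⟩ : ∃ M : ℕ, ∀ w,
      ‖(FreeAlgebra.equivMonoidAlgebraFreeMonoid P).coeff w‖ ≤ (p : ℝ) ^ M := by
    obtain ⟨M, hM⟩ := pow_unbounded_of_one_lt
      (∑ w ∈ (FreeAlgebra.equivMonoidAlgebraFreeMonoid P).coeff.support,
        ‖(FreeAlgebra.equivMonoidAlgebraFreeMonoid P).coeff w‖)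
      (by exact_mod_cast (Fact.out : p.Prime).one_lt : (1 : ℝ) < p)
    refine ⟨M, fun w => ?_⟩
    by_cases hw : w ∈ (FreeAlgebra.equivMonoidAlgebraFreeMonoid P).coeff.support
    · exact (Finset.single_le_sum
        (fun w _ => norm_nonneg ((FreeAlgebra.equivMonoidAlgebraFreeMonoid P).coeff w)) hw).trans
        hM.le
    · rw [Finsupp.notMem_support_iff.1 hw, norm_zero]
      positivity
  refine ⟨M, fun w => ?_⟩
  rw [map_smul, MonoidAlgebra.coeff_smul_apply, smul_eq_mul, norm_mul, norm_pow, norm_natCast_padicAlgCl]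
  have hp0 : (p : ℝ) ≠ 0 := Nat.cast_ne_zero.2 (Fact.out : p.Prime).ne_zero
  calc (p : ℝ)⁻¹ ^ M * ‖(FreeAlgebra.equivMonoidAlgebraFreeMonoid P).coeff w‖
      ≤ (p : ℝ)⁻¹ ^ M * (p : ℝ) ^ M := mul_le_mul_of_nonneg_left (hM w) (by positivity)
    _ = 1 := by rw [← mul_pow, inv_mul_cancel₀ hp0, one_pow]

variable {F : Type} [Field F] [NumberField F]

/-- **`C_s` for all `s` ⇒ every relation is exact on the `x`-values**: if `x mod p^s` factors through
the Hecke algebra of the receptacle for every `s` (`FactorsThroughWeightModP`, INTEGRAL relations),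
then every (not necessarily integral) relation `P(T_{v,i}) = 0` among good `T_{v,i}` on
`H^q(S_{K_f(𝔫)}, Ẽ_λ(ℚ̄_p))` gives `P(x(T_{v,i})) = 0`: scale `P` to an integral `p^M • P`
(`exists_isIntegralPoly_smul`), get `‖p^M P(x)‖ ≤ p^{-s}` for all `s`, hence `0`, and `p^M ≠ 0`.
[folklore] -/
theorem lift_apply_eq_zero_of_forall_factorsThroughWeightModP {𝒰 : TameLevel 2 F p}
    {x : CompletedCohomologyHeckeAlgebraGLn 𝒰 →+* PadicAlgCl p} {𝔫 : Ideal (𝓞 F)}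
    {lam : (F →+* PadicAlgCl p) → Fin 2 → ℤ} {q : ℕ}
    (hC : ∀ s : ℕ, FactorsThroughWeightModP 𝒰 x 𝔫 lam q s) {r : ℕ}
    (ix : Fin r → HeightOneSpectrum (𝓞 F) × ℕ) (hix : ∀ j, (ix j).1 ∉ 𝒰.bad ∧ ¬ (ix j).1.asIdeal ∣ 𝔫)
    (P : FreeAlgebra (PadicAlgCl p) (Fin r))
    (hrel : FreeAlgebra.lift (PadicAlgCl p)
      (fun j => ResGLnCohomology.heckeT (PadicAlgCl p) 2 F 𝔫 lam q (ix j).1 (ix j).2) P = 0) :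
    FreeAlgebra.lift (PadicAlgCl p) (fun j => x (𝒰.heckeT (ix j).1 (ix j).2)) P = 0 := by
  obtain ⟨M, hM⟩ := exists_isIntegralPoly_smul P
  have h0 : FreeAlgebra.lift (PadicAlgCl p) (fun j => x (𝒰.heckeT (ix j).1 (ix j).2))
      ((p : PadicAlgCl p) ^ M • P) = 0 := by
    refine eq_zero_of_forall_norm_le_inv_pow fun s => hC s r ix hix _ hM ?_
    rw [map_smul, hrel, smul_zero]
  rw [map_smul, smul_eq_zero] at h0
  exact h0.resolve_left (pow_ne_zero _ (Nat.cast_ne_zero.2 (Fact.out : p.Prime).ne_zero))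

end Padic

/-! ## 2. The stub -/

/-- **Stub S4 (M; "First lemma" — exact occupancy is FREE inside a finite Hecke algebra), PROVED.**
For ANY number field `F`, `𝔫 ≠ 0`, weight `λ`, degree `q`, with the receptacle
`H = H^q(S_{K_f(𝔫)}, Ẽ_λ(ℚ̄_p))` FINITE-DIMENSIONAL (hypothesis; supplied in the composition by
`stub_finiteDimensional_levelCohomology`): if the eigensystem `x` factors `mod p^s` through the Hecke
algebra of `H` for EVERY `s` (relation currency), then `x` is the eigensystem of a non-zero
simultaneous eigenclass in `H`.  Proof: the hypothesis for all `s` makes every INTEGRAL relation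
among the good `T_{v,i}` on `H` exact on the values `x(T_{v,i})`, hence — scaling by powers of `p` —
every relation (`lift_apply_eq_zero_of_forall_factorsThroughWeightModP`; relations over the infinite
index set of good `(v,i)` involve finitely many letters, `exists_eq_lift_fin`); so `T_{v,i} ↦ x(T_{v,i})`
extends to a `ℚ̄_p`-algebra character `χ` of `B = ℚ̄_p⟨good T_{v,i}⟩ = range (FreeAlgebra.lift T) ⊆ End H`
(`Algebra.adjoin_range_eq_range_freeAlgebra_lift`); `B` is COMMUTATIVE (`ResGLnCohomology.commute_heckeT`:
different unramified places by orthogonality, the same place by Gelfand's trick; the level `K_f(𝔫)`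
is unramified at `v ∤ 𝔫`), and a character of a commutative subalgebra of `End H`, `H`
finite-dimensional, has a non-zero common eigenvector
(`Literature.NumberTheory.Automorphic.exists_ne_zero_forall_apply_eq_smul_of_algHom`).  `H = 0` makes
the hypothesis false (`P = 1`) and is excluded automatically.  This is the `p`-adic LIMIT step of the
line, taken inside a finite Hecke algebra — the reason K0 is absent. [folklore] -/
theorem stub_exactOccupancy : ∀ (F : Type) [Field F] [NumberField F] (p : ℕ) [Fact p.Prime] (𝒰 : Literature.NumberTheory.Automorphic.BigHeckeGLn.TameLevel 2 F p) (x : Literature.NumberTheory.Automorphic.CompletedCohomologyHeckeAlgebraGLn 𝒰 →+* PadicAlgCl p) (𝔫 : Ideal (NumberField.RingOfIntegers F)), 𝔫 ≠ 0 → ∀ (lam : (F →+* PadicAlgCl p) → Fin 2 → ℤ) (q : ℕ), FiniteDimensional (PadicAlgCl p) (Literature.NumberTheory.Automorphic.ResGLnCohomology.levelCohomology (PadicAlgCl p) 2 F 𝔫 lam q) → (∀ s : ℕ, FactorsThroughWeightModP 𝒰 x 𝔫 lam q s) → IsClassicalOfWeight 𝒰 x 𝔫 lam q := by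
  intro F _ _ p _ 𝒰 x 𝔫 h𝔫 lam q hfd hC
  -- the good index set, the operators and the prospective eigenvalues
  let G : Type := {g : HeightOneSpectrum (𝓞 F) × ℕ // g.1 ∉ 𝒰.bad ∧ ¬ g.1.asIdeal ∣ 𝔫}
  let T : G → Module.End (PadicAlgCl p)
      (ResGLnCohomology.levelCohomology (PadicAlgCl p) 2 F 𝔫 lam q) :=
    fun g => ResGLnCohomology.heckeT (PadicAlgCl p) 2 F 𝔫 lam q g.1.1 g.1.2
  let xv : G → PadicAlgCl p := fun g => x (𝒰.heckeT g.1.1 g.1.2)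
  -- (1)+(2): every relation among the good `T_{v,i}` on `H` holds for the `x`-values
  have hkey : ∀ Q : FreeAlgebra (PadicAlgCl p) G,
      FreeAlgebra.lift (PadicAlgCl p) T Q = 0 → FreeAlgebra.lift (PadicAlgCl p) xv Q = 0 := by
    intro Q hQ
    obtain ⟨r, e, Q', rfl⟩ := exists_eq_lift_fin Q
    rw [lift_lift_ι_comp] at hQ ⊢
    exact lift_apply_eq_zero_of_forall_factorsThroughWeightModP hC (fun j => (e j).1)
      (fun j => (e j).2) Q' hQ
  -- (3): the character `χ` of `B = range (lift T)`
  let A : Subalgebra (PadicAlgCl p) (Module.End (PadicAlgCl p)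
      (ResGLnCohomology.levelCohomology (PadicAlgCl p) 2 F 𝔫 lam q)) :=
    (FreeAlgebra.lift (PadicAlgCl p) T).range
  have hsurj : ∀ a : A, ∃ Q : FreeAlgebra (PadicAlgCl p) G,
      FreeAlgebra.lift (PadicAlgCl p) T Q = (a : Module.End (PadicAlgCl p)
        (ResGLnCohomology.levelCohomology (PadicAlgCl p) 2 F 𝔫 lam q)) :=
    fun a => (AlgHom.mem_range _).1 a.2
  choose Qof hQof using hsurj
  have hχ : ∀ (a : A) (Q : FreeAlgebra (PadicAlgCl p) G),
      FreeAlgebra.lift (PadicAlgCl p) T Q = (a : Module.End (PadicAlgCl p)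
        (ResGLnCohomology.levelCohomology (PadicAlgCl p) 2 F 𝔫 lam q)) →
      FreeAlgebra.lift (PadicAlgCl p) xv (Qof a) = FreeAlgebra.lift (PadicAlgCl p) xv Q := by
    intro a Q hQ
    have h := hkey (Qof a - Q) (by rw [map_sub, hQof, hQ, sub_self])
    rwa [map_sub, sub_eq_zero] at h
  let χ : A →ₐ[PadicAlgCl p] PadicAlgCl p :=
    { toFun := fun a => FreeAlgebra.lift (PadicAlgCl p) xv (Qof a)
      map_one' := (hχ 1 1 (by rw [map_one]; rfl)).trans (map_one _)
      map_mul' := fun a b =>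
        (hχ (a * b) (Qof a * Qof b) (by rw [map_mul, hQof, hQof]; rfl)).trans (map_mul _ _ _)
      map_zero' := (hχ 0 0 (by rw [map_zero]; rfl)).trans (map_zero _)
      map_add' := fun a b =>
        (hχ (a + b) (Qof a + Qof b) (by rw [map_add, hQof, hQof]; rfl)).trans (map_add _ _ _)
      commutes' := fun c =>
        (hχ (algebraMap (PadicAlgCl p) A c) (algebraMap (PadicAlgCl p) _ c)
          (by rw [AlgHom.commutes]; rfl)).trans (AlgHom.commutes _ c) }
  -- (4): `B` is commutative
  have hT : ∀ g g' : G, Commute (T g) (T g') := fun g g' =>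
    ResGLnCohomology.commute_heckeT (PadicAlgCl p) 2 F h𝔫 lam q g.2.2 g'.2.2 g.1.2 g'.1.2
  have hadj : ∀ a : A, (a : Module.End (PadicAlgCl p)
      (ResGLnCohomology.levelCohomology (PadicAlgCl p) 2 F 𝔫 lam q)) ∈
        Algebra.adjoin (PadicAlgCl p) (Set.range T) := fun a => by
    rw [Algebra.adjoin_range_eq_range_freeAlgebra_lift]
    exact a.2
  have hA : ∀ a b : A, Commute a b := by
    intro a b
    have h : Commute (a : Module.End (PadicAlgCl p)
        (ResGLnCohomology.levelCohomology (PadicAlgCl p) 2 F 𝔫 lam q)) b := by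
      refine Algebra.commute_of_mem_adjoin_of_forall_mem_commute (hadj b) ?_
      rintro _ ⟨g, rfl⟩
      refine (Algebra.commute_of_mem_adjoin_of_forall_mem_commute (a := T g) (hadj a) ?_).symm
      rintro _ ⟨g', rfl⟩
      exact hT g g'
    exact Subtype.ext h.eq
  -- (5): a character of a commutative algebra of endomorphisms of a finite-dimensional space
  -- has a non-zero common eigenvector
  haveI : FiniteDimensional (PadicAlgCl p)
      (ResGLnCohomology.levelCohomology (PadicAlgCl p) 2 F 𝔫 lam q) := hfd
  obtain ⟨c, hc0, hc⟩ := exists_ne_zero_forall_apply_eq_smul_of_algHom A hA χ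
  refine ⟨c, hc0, fun v hv hvn i => ?_⟩
  let g : G := ⟨(v, i), hv, hvn⟩
  have hmem : T g ∈ A :=
    (AlgHom.mem_range _).2 ⟨FreeAlgebra.ι (PadicAlgCl p) g, FreeAlgebra.lift_ι_apply _ _⟩
  have h1 := hc ⟨T g, hmem⟩
  have h2 : χ ⟨T g, hmem⟩ = xv g :=
    (hχ ⟨T g, hmem⟩ (FreeAlgebra.ι (PadicAlgCl p) g) (FreeAlgebra.lift_ι_apply _ _)).trans
      (FreeAlgebra.lift_ι_apply _ _)
  rw [h2] at h1
  exact h1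

end Summit.Langlands.Langlands.Cruxes.CrystallineProModularClassical.TorsionWeightExchange

end
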